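import Mathlib
import Summits.AtomisticToContinuum.HydrodynamicLimit.Theorems.InformationPercolationEngineKickFairRelEquilibriumMesoWindowCut
import Summits.AtomisticToContinuum.HydrodynamicLimit.Theorems.InformationPercolationEngineKickFairRelEquilibriumMesoReductionA
import HarnessLib

/-!
# `KickFairRelEquilibriumMeso`, ALT line `kinetic-window-cut` — stub WR `stub_windowReduction`

Prover file (`--supports stmt-AtomisticToContinuum-15177`, wave 4, lead c7) proving the registered stub
`stub_windowReduction : SingleKickBias rs → SameWindowPairCov rs → CountExcessLG → ClosePairCount rs → MesoBody rs` of the checked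
skeleton `Cruxes/KickFairRelEquilibriumMeso/Lines/kinetic_window_cut.lean` (strategist s1, rev 2): the kinetic-window cut
`truncatedFluctuation_of_window` (SW ∧ CP ⟹ TF, `…MesoWindowCut`) composed with the landed first half of the reduction
`stub_reductionA` (B1 ∧ CT-a ∧ TF ⟹ the body of the crux, `…MesoReductionA`).
-/

noncomputable section

namespace Summit.AtomisticToContinuum.HydrodynamicLimit.Theorems.KickFairRelEquilibriumMesoLine

open Summit.AtomisticToContinuum.HydrodynamicLimit.Theorems.KickFairRelEquilibriumMesoNegative (MesoBody KickBoundRel)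

/-- **STUB WR `stub_windowReduction` — the kinetic-window reduction.** B1 (single-kick conditional bias), SW (same-window
cell-far pair conditional covariance), CT-a (count excess) and CP (close same-window pair count) give the body of the crux along
`rs N = (N+1)^{-1/4}`: SW and CP give the truncated fluctuation bound TF by the window cut (`truncatedFluctuation_of_window`), and
B1, CT-a, TF give `MesoBody rs` (`stub_reductionA`). [folklore] -/
theorem stub_windowReduction :
    SingleKickBias rs → SameWindowPairCov rs → CountExcessLG → ClosePairCount rs → MesoBody rs :=
  fun hB1 hSW hCa hCP => stub_reductionA hB1 hCa (truncatedFluctuation_of_window hSW hCP)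

end Summit.AtomisticToContinuum.HydrodynamicLimit.Theorems.KickFairRelEquilibriumMesoLine

end
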